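import Literature.Topology.PlanarFoliations.ChainLimit
import Literature.Topology.PlanarFoliations.SeparatrixEnds
import Literature.Topology.PlanarFoliations.WalkBuild
import HarnessLib

/-!
# Frontier separatrices of the limit set of a chain, and the states of the hugged walk

Topic: Topology / PlanarFoliations, sequel to `ChainLimit.lean` (the limit set `Dlim` of a
strictly decreasing chain of discs of compact leaves and the dichotomy for its frontier leaves),
`SeparatrixEnds.lean` (tails of separatrices at their limit punctures), `WalkBuild.lean`.
Standing hypotheses: a star configuration `D`, the chain `K` with first disc in the region, and
**no compact frontier leaf**. Then every leaf through a frontier point of `Dlim` is a **frontier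
separatrix**: a line leaf inside the first disc whose ω- and α-limit sets are single saddles
(`vω`, `vα`), with forward and backward prong tails there.

* `ProngStar.FwdTail.j_eq`, `ProngStar.BwdTail.j_eq` (**proved**): two forward (backward) tails of
  one leaf at one star sit on the same prong;
* `StarData.HugHyp` (**structure**, `Prop`): the standing hypotheses, with the API of frontier
  separatrices (`nc`, `mem_disc`, `sep`, `vω`, `vα`, `omegaSet_eq`, `alphaSet_eq`,
  `nonempty_fwdTail`, `nonempty_bwdTail`);
* `StarData.HugState` (**structure**): a frontier point `y` (the separatrix that has just arrived);
  its arrival saddle `v`, arrival prong `jin` (well defined by the above: `jin_eq`) and the next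
  prong `jout s` on the side `s` (the turning rule of `WalkFence`).

All statements are [folklore].
-/

noncomputable section

open Set Filter Function Metric
open _root_.Topology
open Literature.Topology.FourManifolds Literature.Topology.FourManifolds.Foliation

namespace Literature.Topology.PlanarFoliations

variable {X : Type*} [TopologicalSpace X] [T2Space X] [SecondCountableTopology X] {F : Foliation ℝ X} {ι : X → ℂ}

/-! ## Tails of one leaf at one star sit on one prong -/

namespace ProngStar

variable [Nonempty X] {v : ℂ} {n : ℕ} {P : ProngStar F ι v n} {hbi : IsBiOriented F} {x : X} [NoncompactSpace (F.Leaf x)]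

omit [Nonempty X] in
/-- **Two forward tails of a leaf at a star are on the same prong.** [folklore] -/
theorem FwdTail.j_eq (E E' : P.FwdTail hbi x) : E.j = E'.j := by
  -- the later base point is in both forward half-leaves
  have key : ∀ (E E' : P.FwdTail hbi x), E'.p ∈ fwd hbi E.p → E.j = E'.j := by
    intro E E' hmem
    obtain ⟨β, hβ, hβp⟩ := (E.fwd_iff _).1 hmem
    have h1 : P.pt E'.j (E'.β₀, 0) ∈ P.S E.j := by
      rw [← E'.hp, hβp]
      exact P.pt_mem ((P.mem_rect_iff).2 ⟨⟨hβ.1.le, hβ.2.trans E.hβ₀.2⟩, by simp [P.ρ_pos.le]⟩)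
    exact P.eq_of_pt_mem_S E'.hβ₀ h1
  rcases leafLT_trichotomy (hbi := hbi) E.p E'.p with h | h | h
  · exact key E E' (mem_fwd_of_leafLT h)
  · exact key E E' (h ▸ mem_fwd_self _)
  · exact (key E' E (mem_fwd_of_leafLT h)).symm

omit [Nonempty X] in
/-- **Two backward tails of a leaf at a star are on the same prong.** [folklore] -/
theorem BwdTail.j_eq (E E' : P.BwdTail hbi x) : E.j = E'.j := by
  have key : ∀ (E E' : P.BwdTail hbi x), E'.p ∈ bwd hbi E.p → E.j = E'.j := by
    intro E E' hmem
    obtain ⟨β, hβ, hβp⟩ := (E.bwd_iff _).1 hmem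
    have h1 : P.pt E'.j (E'.β₀, 0) ∈ P.S E.j := by
      rw [← E'.hp, hβp]
      exact P.pt_mem ((P.mem_rect_iff).2 ⟨⟨hβ.1.le, hβ.2.trans E.hβ₀.2⟩, by simp [P.ρ_pos.le]⟩)
    exact P.eq_of_pt_mem_S E'.hβ₀ h1
  rcases leafLT_trichotomy (hbi := hbi) E.p E'.p with h | h | h
  · exact (key E' E (show E.p ∈ bwd hbi E'.p from fun h' ↦ leafLT_asymm h h')).symm
  · exact key E E' (h ▸ mem_bwd_self _)
  · exact key E E' (show E'.p ∈ bwd hbi E.p from fun h' ↦ leafLT_asymm h h')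

end ProngStar

/-! ## Frontier separatrices -/

namespace StarData

variable {B : Type*} [NormedAddCommGroup B] {M : Type*} [TopologicalSpace M] {T : Foliation B M} {g : ℂ → M}

/-- **The standing hypotheses of the hugging argument**: a strictly decreasing chain of discs of
compact leaves `K n`, the first disc in the region, and no compact leaf through a frontier point of
the limit set. [folklore] -/
structure HugHyp (D : StarData F ι T g) (hbi : IsBiOriented F) (hι : IsOpenEmbedding ι) (K : ℕ → X) : Prop where
  hK : ∀ n, IsCompact (F.leaf (K n))
  hdec : ∀ n, discLeaf F ι (K (n + 1)) ⊂ discLeaf F ι (K n)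
  hΩ : discLeaf F ι (K 0) ⊆ D.Ω
  hfr : ∀ y, ι y ∈ frontier (Dlim ι F K) → ¬ IsCompact (F.leaf y)

namespace HugHyp

variable {D : StarData F ι T g} {hbi : IsBiOriented F} {hι : IsOpenEmbedding ι} {K : ℕ → X} (H : D.HugHyp hbi hι K)
variable {y : X} (hy : ι y ∈ frontier (Dlim ι F K))

include H hy in
omit [T2Space X] [SecondCountableTopology X] in
/-- A frontier leaf is a line leaf. [folklore] -/
theorem nc : NoncompactSpace (F.Leaf y) := noncompactSpace_leaf_of_not_isCompact' (H.hfr y hy)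

include H hy in
/-- A frontier leaf lies in the first disc. [folklore] -/
theorem mem_disc (q : F.Leaf y) : ι (Leaf.pt q) ∈ discLeaf F ι (K 0) :=
  mem_iInter.1 (image_leaf_subset_Dlim hbi hι H.hK H.hdec ((isCompact_Dlim hbi hι H.hK).isClosed.frontier_subset hy)
    ⟨Leaf.pt q, q.2, rfl⟩) 0

include H hy in
/-- The points of a frontier leaf are frontier points. [folklore] -/
theorem frontier_of_mem_leaf {y' : X} (hy' : y' ∈ F.leaf y) : ι y' ∈ frontier (Dlim ι F K) :=
  isSaturated_preimage_frontier hbi hι H.hK H.hdec y hy hy'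

include H hy in
/-- **The frontier dichotomy without compact leaves**: the frontier leaf is a separatrix with single
saddle limit sets. [folklore] -/
theorem sep : ∃ _ : NoncompactSpace (F.Leaf y),
    (∃ v ∈ D.P, omegaSet hbi ι y = {v} ∧ ∃ s ∈ D.levelLeaves v, y ∈ F.leaf s) ∧
    (∃ v ∈ D.P, alphaSet hbi ι y = {v} ∧ ∃ s ∈ D.levelLeaves v, y ∈ F.leaf s) :=
  (isCompact_or_of_mem_frontier_Dlim D.toPunctureData hbi hι H.hK H.hdec H.hΩ hy).resolve_left (H.hfr y hy)

/-- **The ω-saddle** of the frontier leaf. [folklore] -/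
def vω : ℂ := (H.sep hy).2.1.choose

/-- **The α-saddle** of the frontier leaf. [folklore] -/
def vα : ℂ := (H.sep hy).2.2.choose

/-- The ω-saddle is a puncture. [folklore] -/
theorem vω_mem : H.vω hy ∈ D.P := (H.sep hy).2.1.choose_spec.1

/-- The α-saddle is a puncture. [folklore] -/
theorem vα_mem : H.vα hy ∈ D.P := (H.sep hy).2.2.choose_spec.1

/-- The ω-limit set is the ω-saddle. [folklore] -/
theorem omegaSet_eq : haveI := H.nc hy; omegaSet hbi ι y = {H.vω hy} := (H.sep hy).2.1.choose_spec.2.1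

/-- The α-limit set is the α-saddle. [folklore] -/
theorem alphaSet_eq : haveI := H.nc hy; alphaSet hbi ι y = {H.vα hy} := (H.sep hy).2.2.choose_spec.2.1

/-- The ω-saddle is a saddle. [folklore] -/
theorem nprong_vω_ne_zero : D.nprong (H.vω hy) ≠ 0 :=
  haveI := H.nc hy
  D.nprong_ne_zero_of_omegaSet (H.vω_mem hy) (isCompact_discLeaf hbi hι (H.hK 0)) (H.mem_disc hy) (H.omegaSet_eq hy)

/-- The α-saddle is a saddle. [folklore] -/
theorem nprong_vα_ne_zero : D.nprong (H.vα hy) ≠ 0 :=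
  haveI := H.nc hy
  D.nprong_ne_zero_of_alphaSet (H.vα_mem hy) (isCompact_discLeaf hbi hι (H.hK 0)) (H.mem_disc hy) (H.alphaSet_eq hy)

/-- **A forward tail at the ω-saddle.** [folklore] -/
theorem nonempty_fwdTail : haveI := H.nc hy; Nonempty ((D.star _ (H.nprong_vω_ne_zero hy)).FwdTail hbi y) :=
  haveI := H.nc hy
  (D.exists_fwdTail hι (H.vω_mem hy) (isCompact_discLeaf hbi hι (H.hK 0)) (H.mem_disc hy) (H.omegaSet_eq hy)).snd

/-- **A backward tail at the α-saddle.** [folklore] -/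
theorem nonempty_bwdTail : haveI := H.nc hy; Nonempty ((D.star _ (H.nprong_vα_ne_zero hy)).BwdTail hbi y) :=
  haveI := H.nc hy
  (D.exists_bwdTail hι (H.vα_mem hy) (isCompact_discLeaf hbi hι (H.hK 0)) (H.mem_disc hy) (H.alphaSet_eq hy)).snd

end HugHyp

/-! ## States of the hugged walk -/

/-- **A state of the hugged walk**: a frontier point — the frontier separatrix that has just
arrived at its ω-saddle. [folklore] -/
structure HugState (ι : X → ℂ) (F : Foliation ℝ X) (K : ℕ → X) where
  /-- a point of the separatrix -/
  y : X
  hy : ι y ∈ frontier (Dlim ι F K)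

namespace HugState

variable {D : StarData F ι T g} {hbi : IsBiOriented F} {hι : IsOpenEmbedding ι} {K : ℕ → X} (H : D.HugHyp hbi hι K)
  (st : HugState ι F K)

/-- The arrival saddle. [folklore] -/
def v : ℂ := H.vω st.hy

/-- The arrival saddle is a saddle. [folklore] -/
theorem hv : D.nprong (st.v H) ≠ 0 := H.nprong_vω_ne_zero st.hy

include H in
omit [T2Space X] [SecondCountableTopology X] in
/-- The state's leaf is a line leaf. [folklore] -/
theorem nc : NoncompactSpace (F.Leaf st.y) := H.nc st.hy

/-- The chosen arrival tail. [folklore] -/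
def Ef : haveI := st.nc H; (D.star _ (st.hv H)).FwdTail hbi st.y := Classical.choice (H.nonempty_fwdTail st.hy)

/-- **The arrival prong.** [folklore] -/
def jin : ZMod (D.nprong (st.v H)) := haveI := st.nc H; (st.Ef H).j

/-- The arrival prong does not depend on the choice of the tail. [folklore] -/
theorem jin_eq (E : haveI := st.nc H; (D.star _ (st.hv H)).FwdTail hbi st.y) : haveI := st.nc H; E.j = st.jin H := by
  haveI := st.nc H
  show E.j = (st.Ef H).j
  exact ProngStar.FwdTail.j_eq E (st.Ef H)

/-- **The next prong on the side `s`** (the turning rule, as in `WalkJunction.turn`). [folklore] -/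
def jout (s : ℝ) : ZMod (D.nprong (st.v H)) :=
  if 0 ≤ (D.star _ (st.hv H)).sg (st.jin H) * s then st.jin H + 1 else st.jin H - 1

/-- The arrival saddle is the ω-limit set. [folklore] -/
theorem omegaSet_eq : haveI := st.nc H; omegaSet hbi ι st.y = {st.v H} := H.omegaSet_eq st.hy

end HugState

end StarData

end Literature.Topology.PlanarFoliations
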